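import Literature.AlgebraicGeometry.HyperbolicPolynomials.Garding
import Literature.AlgebraicGeometry.HyperbolicPolynomials.DerivativeCone
import HarnessLib

/-!
# Gårding's inequality: `p(x)^{1/m}` is concave on the hyperbolicity cone

Topic `Literature/AlgebraicGeometry/HyperbolicPolynomials`, companion of `Garding.lean` (convexity of the
cones, hyperbolicity in every direction of the cone) and `HyperbolicityCone.lean` (eigenvalues,
`p(x) = p(e) ∏ λᵢ(x)`). Gårding's 1959 paper is titled *An inequality for hyperbolic polynomials*; the
inequality, in the form in which it is used in convex optimisation, is

> **Lemma 3.1** (Güler 1997; "referred to as Gårding's inequality"; proof from Hörmander, *Notions of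
> Convexity*, Prop. 2.1.31). Let `p ∈ Hyp(d; m)`. Then the function `p(x)^{1/m}` is concave and
> homogeneous of degree 1 in `K(p; d)`, and vanishes on the boundary of `K(p; d)`.

(Bauschke–Güler–Lewis–Sendov 2001, Cor. 3.10: "Suppose `p(d) > 0`. Then the function `x ↦ -p(x)^{1/m}` is
sublinear on the hyperbolicity cone `C(d)`, and it vanishes on its boundary.") Here `K(p; d) = C(d)` is the
open cone `openHyperbolicityCone p d = Λ₊₊` of the tree, its closure is `hyperbolicityCone p d = Λ₊`
(`hyperbolicityCone_eq_closure`), and we normalise by `p(d)` instead of assuming `p(d) > 0`: the function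
studied is

  `x ↦ (p(x) / p(e))^{1/m}`, written `(MvPolynomial.eval x f / MvPolynomial.eval e f) ^ ((d : ℝ)⁻¹)`

(real power `Real.rpow`; on `Λ₊` the base `p(x)/p(e) = ∏ λᵢ(x)` is `≥ 0`).

## Main results (namespace `Literature.AlgebraicGeometry.HyperbolicPolynomials`), for a form `f` of degree
`d ≥ 1` hyperbolic w.r.t. `e`

* `eval_div_eval_eq_prod_eigenvalues`, `eval_div_eval_nonneg`, `eval_div_eval_pos` — `p(x)/p(e) = ∏ λᵢ(x)`
  is `≥ 0` on `Λ₊` and `> 0` on `Λ₊₊`.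
* `rpow_eval_add_ge_of_mem_openHyperbolicityCone`, `rpow_eval_add_ge` — **Gårding's inequality,
  superadditive form**: `(p(x+y)/p(e))^{1/m} ≥ (p(x)/p(e))^{1/m} + (p(y)/p(e))^{1/m}` for `x, y ∈ Λ₊`.
* `rpow_eval_smul` — positive homogeneity of degree `1`.
* `concaveOn_rpow_eval_hyperbolicityCone`, `concaveOn_rpow_eval_openHyperbolicityCone` — **Güler's
  Lemma 3.1 / BGLS Cor. 3.10**: concavity on `Λ₊` and on `Λ₊₊`; `rpow_eval_eq_zero_of_mem_frontier` — it
  vanishes on the boundary.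
* `eval_add_ge_add` — the weaker polynomial form `p(x + y)/p(e) ≥ p(x)/p(e) + p(y)/p(e)` on `Λ₊`
  (e.g. Minkowski's `det(A + B) ≥ det A + det B` for `A, B ⪰ 0`).
* `eigenvalues_add_ge` — **Gårding: `λ_min` is concave** (BGLS Thm 2.5 "the largest characteristic root
  is sublinear", equivalently `λ_min(x + y) ≥ λ_min(x) + λ_min(y)`), stated through lower bounds of the
  eigenvalue multisets.

Proof of the inequality (Hörmander's route in multiplicative form): for `y ∈ Λ₊₊(p, e)` the form is
hyperbolic w.r.t. `y` with the same cones (Gårding, `Garding.lean`), so `p(x) = p(y) ∏ μᵢ` and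
`p(x + y) = p(y) ∏ (1 + μᵢ)` with `μᵢ ≥ 0` the eigenvalues of `x ∈ Λ₊` in direction `y`; the
superadditivity of the geometric mean, `(∏(1 + μᵢ))^{1/m} ≥ 1 + (∏ μᵢ)^{1/m}` (from the AM–GM inequality),
finishes. No named facts are introduced.

## References

* [Guler1997] O. Güler, *Hyperbolic polynomials and interior point methods for convex programming*, Math.
  Oper. Res. 22 (1997) 350–377: Lemma 3.1 (p. 12 of the preprint text).
* [BauschkeEtAl2001] H. H. Bauschke, O. Güler, A. S. Lewis, H. S. Sendov, *Hyperbolic polynomials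
  and convex analysis*, Canad. J. Math. 53 (2001) 470–488: Thm. 2.5, Cor. 3.10.
* [Garding1959] L. Gårding, *An inequality for hyperbolic polynomials*, J. Math. Mech. 8 (1959) 957–965,
  Thm. 2 (`λ_m` concave) and the title inequality.
-/

noncomputable section

open MvPolynomial Finset

namespace Literature.AlgebraicGeometry.HyperbolicPolynomials

/-! ## §1 Superadditivity of the geometric mean -/

section GeomMean

/-- **Superadditivity of the geometric mean** (a consequence of the AM–GM inequality):
`(∏ aᵢ)^{1/n} + (∏ bᵢ)^{1/n} ≤ (∏ (aᵢ + bᵢ))^{1/n}` for `aᵢ, bᵢ ≥ 0`. [folklore] -/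
private theorem geomMean_add_geomMean_le {ι : Type*} {s : Finset ι} (hs : s.Nonempty) {a b : ι → ℝ}
    (ha : ∀ i ∈ s, 0 ≤ a i) (hb : ∀ i ∈ s, 0 ≤ b i) :
    (∏ i ∈ s, a i) ^ ((s.card : ℝ)⁻¹) + (∏ i ∈ s, b i) ^ ((s.card : ℝ)⁻¹) ≤
      (∏ i ∈ s, (a i + b i)) ^ ((s.card : ℝ)⁻¹) := by
  have hn : (0 : ℝ) < s.card := by exact_mod_cast hs.card_pos
  have hninv : (s.card : ℝ)⁻¹ ≠ 0 := inv_ne_zero hn.ne'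
  by_cases h0 : ∃ i ∈ s, a i + b i = 0
  · obtain ⟨i, hi, h⟩ := h0
    have hai : a i = 0 := by linarith [ha i hi, hb i hi]
    have hbi : b i = 0 := by linarith [ha i hi, hb i hi]
    rw [Finset.prod_eq_zero hi hai, Finset.prod_eq_zero hi hbi, Real.zero_rpow hninv, add_zero]
    exact Real.rpow_nonneg (Finset.prod_nonneg fun j hj => add_nonneg (ha j hj) (hb j hj)) _
  · push Not at h0
    have hpos : ∀ i ∈ s, 0 < a i + b i := fun i hi =>
      (add_nonneg (ha i hi) (hb i hi)).lt_of_ne (h0 i hi).symm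
    set P := ∏ i ∈ s, (a i + b i) with hP
    have hP0 : 0 < P := Finset.prod_pos hpos
    have key : ∀ c : ι → ℝ, (∀ i ∈ s, 0 ≤ c i) →
        (∏ i ∈ s, c i) ^ ((s.card : ℝ)⁻¹) / P ^ ((s.card : ℝ)⁻¹) ≤
          (∑ i ∈ s, c i / (a i + b i)) / s.card := by
      intro c hc
      have h := Real.geom_mean_le_arith_mean s (fun _ => (1 : ℝ)) (fun i => c i / (a i + b i))
        (fun _ _ => zero_le_one) (by simpa using hn) (fun i hi => div_nonneg (hc i hi) (hpos i hi).le)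
      simp only [Real.rpow_one, one_mul, Finset.sum_const, nsmul_eq_mul, mul_one] at h
      rwa [Finset.prod_div_distrib, Real.div_rpow (Finset.prod_nonneg hc) hP0.le] at h
    have hsum : (∑ i ∈ s, a i / (a i + b i)) / s.card + (∑ i ∈ s, b i / (a i + b i)) / s.card = 1 := by
      rw [← add_div, ← Finset.sum_add_distrib]
      have : ∑ i ∈ s, (a i / (a i + b i) + b i / (a i + b i)) = ∑ i ∈ s, (1 : ℝ) :=
        Finset.sum_congr rfl fun i hi => by rw [← add_div, div_self (hpos i hi).ne']
      rw [this, Finset.sum_const, nsmul_eq_mul, mul_one, div_self hn.ne']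
    have hPr : 0 < P ^ ((s.card : ℝ)⁻¹) := Real.rpow_pos_of_pos hP0 _
    have h12 := add_le_add (key a ha) (key b hb)
    rw [hsum, ← add_div, div_le_one hPr] at h12
    exact h12

/-- The case `aᵢ = 1`: `1 + (∏ μᵢ)^{1/n} ≤ (∏ (1 + μᵢ))^{1/n}` for `μᵢ ≥ 0`, over `Fin n`, `n ≥ 1`.
[folklore] -/
private theorem one_add_geomMean_le {n : ℕ} (hn : 0 < n) {μ : Fin n → ℝ} (hμ : ∀ i, 0 ≤ μ i) :
    1 + (∏ i, μ i) ^ ((n : ℝ)⁻¹) ≤ (∏ i, (1 + μ i)) ^ ((n : ℝ)⁻¹) := by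
  have h := geomMean_add_geomMean_le (s := (Finset.univ : Finset (Fin n))) ⟨⟨0, hn⟩, Finset.mem_univ _⟩
    (a := fun _ => (1 : ℝ)) (b := μ) (fun _ _ => zero_le_one) (fun i _ => hμ i)
  simpa only [Finset.card_univ, Fintype.card_fin, Finset.prod_const_one, Real.one_rpow] using h

end GeomMean

/-! ## §2 The normalised value `p(x)/p(e)` on the cones -/

section Value

variable {σ : Type*} {f : MvPolynomial σ ℝ} {d : ℕ} {e : σ → ℝ}

/-- `p(x)/p(e) = ∏ λᵢ(x)` (Renegar: `p(x) = p(e) ∏ λᵢ(x)`). [cite: Renegar2006, §2] -/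
theorem eval_div_eval_eq_prod_eigenvalues (hf : f.IsHomogeneous d) (he : IsHyperbolic f e) (x : σ → ℝ) :
    MvPolynomial.eval x f / MvPolynomial.eval e f = (eigenvalues f e x).prod := by
  rw [eval_eq_eval_mul_prod_eigenvalues hf he x, mul_div_cancel_left₀ _ he.eval_ne_zero]

/-- On the closed cone `Λ₊`, `p(x)/p(e) ≥ 0`. [cite: Renegar2006, §2] -/
theorem eval_div_eval_nonneg (hf : f.IsHomogeneous d) (he : IsHyperbolic f e) {x : σ → ℝ}
    (hx : x ∈ hyperbolicityCone f e) : 0 ≤ MvPolynomial.eval x f / MvPolynomial.eval e f := by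
  rw [eval_div_eval_eq_prod_eigenvalues hf he]
  exact Multiset.prod_nonneg fun lam hlam =>
    (mem_hyperbolicityCone_iff_eigenvalues_nonneg hf he x).1 hx lam hlam

/-- On the open cone `Λ₊₊`, `p(x)/p(e) > 0` ("`p(x) > 0` on `K(p; d)`" when `p(d) > 0`).
[cite: Guler1997, §3 (before Lemma 3.1)] -/
theorem eval_div_eval_pos (hf : f.IsHomogeneous d) (he : IsHyperbolic f e) {x : σ → ℝ}
    (hx : x ∈ openHyperbolicityCone f e) : 0 < MvPolynomial.eval x f / MvPolynomial.eval e f := by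
  rw [eval_div_eval_eq_prod_eigenvalues hf he]
  exact Multiset.prod_pos fun lam hlam =>
    (mem_openHyperbolicityCone_iff_eigenvalues_pos hf he x).1 hx lam hlam

/-- The function vanishes on the boundary of the cone: `p(x) = 0` for `x ∈ ∂Λ₊` ("vanishes on the boundary
of `K(p; d)`"). [cite: Guler1997, Lemma 3.1] -/
theorem rpow_eval_eq_zero_of_mem_frontier (hf : f.IsHomogeneous d) (he : IsHyperbolic f e) (hd : 0 < d)
    {x : σ → ℝ} (hx : x ∈ frontier (hyperbolicityCone f e)) :
    (MvPolynomial.eval x f / MvPolynomial.eval e f) ^ ((d : ℝ)⁻¹) = 0 := by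
  rw [frontier_hyperbolicityCone hf he] at hx
  rw [hx.2, zero_div, Real.zero_rpow (inv_ne_zero (by exact_mod_cast hd.ne'))]

/-- **Positive homogeneity of degree one**: `(p(cx)/p(e))^{1/m} = c (p(x)/p(e))^{1/m}` for `c ≥ 0`,
`x ∈ Λ₊`. [cite: Guler1997, Lemma 3.1] -/
theorem rpow_eval_smul (hf : f.IsHomogeneous d) (he : IsHyperbolic f e) (hd : 0 < d) {x : σ → ℝ}
    (hx : x ∈ hyperbolicityCone f e) {c : ℝ} (hc : 0 ≤ c) :
    (MvPolynomial.eval (c • x) f / MvPolynomial.eval e f) ^ ((d : ℝ)⁻¹) =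
      c * (MvPolynomial.eval x f / MvPolynomial.eval e f) ^ ((d : ℝ)⁻¹) := by
  rw [hf.eval_smul_eq, mul_div_assoc, Real.mul_rpow (pow_nonneg hc d) (eval_div_eval_nonneg hf he hx),
    ← Real.rpow_natCast, ← Real.rpow_mul hc, mul_inv_cancel₀ (by exact_mod_cast hd.ne'), Real.rpow_one]

end Value

/-! ## §3 Gårding's inequality -/

section Garding

variable {σ : Type*} {f : MvPolynomial σ ℝ} {d : ℕ} {e : σ → ℝ}

/-- **Gårding's inequality, core case**: for `x ∈ Λ₊(p, e)` and `y ∈ Λ₊₊(p, e)`,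
`(p(x)/p(e))^{1/m} + (p(y)/p(e))^{1/m} ≤ (p(x + y)/p(e))^{1/m}`. In direction `y` one has
`p(x) = p(y) ∏ μᵢ`, `p(x + y) = p(y) ∏ (1 + μᵢ)` with `μᵢ ≥ 0`, and `(∏(1 + μᵢ))^{1/m} ≥ 1 + (∏ μᵢ)^{1/m}`.
[cite: Guler1997, Lemma 3.1] [cite: BauschkeEtAl2001, Cor. 3.10] -/
theorem rpow_eval_add_ge_of_mem_openHyperbolicityCone (hf : f.IsHomogeneous d) (he : IsHyperbolic f e)
    (hd : 0 < d) {x y : σ → ℝ} (hx : x ∈ hyperbolicityCone f e) (hy : y ∈ openHyperbolicityCone f e) :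
    (MvPolynomial.eval x f / MvPolynomial.eval e f) ^ ((d : ℝ)⁻¹) +
        (MvPolynomial.eval y f / MvPolynomial.eval e f) ^ ((d : ℝ)⁻¹) ≤
      (MvPolynomial.eval (x + y) f / MvPolynomial.eval e f) ^ ((d : ℝ)⁻¹) := by
  have hyh : IsHyperbolic f y := he.of_mem_openHyperbolicityCone hf hy
  have hxy : x ∈ hyperbolicityCone f y := by rwa [hyperbolicityCone_eq_of_mem hf he hy]
  obtain ⟨v, hv⟩ := exists_eigenvalues_eq_map hf hyh x
  have hv0 : ∀ i, 0 ≤ v i := fun i =>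
    (mem_hyperbolicityCone_iff_eigenvalues_nonneg hf hyh x).1 hxy (v i)
      (by rw [← hv]; exact Multiset.mem_map_of_mem _ (Finset.mem_univ_val i))
  have hc : 0 < MvPolynomial.eval y f / MvPolynomial.eval e f := eval_div_eval_pos hf he hy
  set c := MvPolynomial.eval y f / MvPolynomial.eval e f with hcdef
  -- `p(x)/p(e) = c ∏ vᵢ` and `p(x+y)/p(e) = c ∏ (1 + vᵢ)`
  have hX : MvPolynomial.eval x f / MvPolynomial.eval e f = c * ∏ i, v i := by
    rw [eval_eq_eval_mul_prod_eigenvalues hf hyh x, ← hv, ← Finset.prod_eq_multiset_prod, hcdef]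
    ring
  have hXY : MvPolynomial.eval (x + y) f / MvPolynomial.eval e f = c * ∏ i, (1 + v i) := by
    have h1 := eval_add_smul_eq_eval_mul_prod_eigenvalues hf hyh x 1
    rw [one_smul] at h1
    rw [h1, ← hv, Multiset.map_map, ← Finset.prod_eq_multiset_prod, hcdef]
    simp only [Function.comp]
    ring
  have hpv : 0 ≤ ∏ i, v i := Finset.prod_nonneg fun i _ => hv0 i
  have hpv1 : 0 ≤ ∏ i, (1 + v i) := Finset.prod_nonneg fun i _ => add_nonneg zero_le_one (hv0 i)
  rw [hX, hXY, Real.mul_rpow hc.le hpv, Real.mul_rpow hc.le hpv1]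
  have hm := one_add_geomMean_le hd hv0
  have hcr : 0 ≤ c ^ ((d : ℝ)⁻¹) := Real.rpow_nonneg hc.le _
  have := mul_le_mul_of_nonneg_left hm hcr
  linarith [this]

/-- **Gårding's inequality (superadditive form) on the closed cone**: for `x, y ∈ Λ₊(p, e)` and `m ≥ 1`,
`(p(x)/p(e))^{1/m} + (p(y)/p(e))^{1/m} ≤ (p(x + y)/p(e))^{1/m}`. (If `p(x) = p(y) = 0` both terms on the
left vanish; otherwise one of `x, y` lies in `Λ₊₊` and the core case applies.) [cite: Guler1997, Lemma 3.1]
[cite: BauschkeEtAl2001, Cor. 3.10] -/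
theorem rpow_eval_add_ge (hf : f.IsHomogeneous d) (he : IsHyperbolic f e) (hd : 0 < d) {x y : σ → ℝ}
    (hx : x ∈ hyperbolicityCone f e) (hy : y ∈ hyperbolicityCone f e) :
    (MvPolynomial.eval x f / MvPolynomial.eval e f) ^ ((d : ℝ)⁻¹) +
        (MvPolynomial.eval y f / MvPolynomial.eval e f) ^ ((d : ℝ)⁻¹) ≤
      (MvPolynomial.eval (x + y) f / MvPolynomial.eval e f) ^ ((d : ℝ)⁻¹) := by
  by_cases hy0 : MvPolynomial.eval y f ≠ 0
  · exact rpow_eval_add_ge_of_mem_openHyperbolicityCone hf he hd hx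
      (mem_openHyperbolicityCone_of_eval_ne_zero hy hy0)
  by_cases hx0 : MvPolynomial.eval x f ≠ 0
  · rw [add_comm, add_comm x y]
    exact rpow_eval_add_ge_of_mem_openHyperbolicityCone hf he hd hy
      (mem_openHyperbolicityCone_of_eval_ne_zero hx hx0)
  push Not at hx0 hy0
  have hd' : ((d : ℝ)⁻¹) ≠ 0 := inv_ne_zero (by exact_mod_cast hd.ne')
  rw [hx0, hy0, zero_div, Real.zero_rpow hd', add_zero]
  -- `x + y = 2 • (½ x + ½ y) ∈ Λ₊`
  have hxy : x + y ∈ hyperbolicityCone f e := by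
    have h := convex_hyperbolicityCone hf he hx hy (a := 2⁻¹) (b := 2⁻¹) (by norm_num) (by norm_num)
      (by norm_num)
    have h2 := smul_mem_hyperbolicityCone hf h (c := 2) two_pos
    rwa [smul_add, smul_smul, smul_smul, mul_inv_cancel₀ (two_ne_zero), one_smul, one_smul] at h2
  exact Real.rpow_nonneg (eval_div_eval_nonneg hf he hxy) _

/-- **Güler 1997, Lemma 3.1 / Gårding's inequality (concave form) on the closed cone**: for a form `p` of
degree `m ≥ 1` hyperbolic w.r.t. `e`, the function `x ↦ (p(x)/p(e))^{1/m}` is concave on `Λ₊(p, e)`.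
[cite: Guler1997, Lemma 3.1] [cite: BauschkeEtAl2001, Cor. 3.10] -/
theorem concaveOn_rpow_eval_hyperbolicityCone (hf : f.IsHomogeneous d) (he : IsHyperbolic f e)
    (hd : 0 < d) :
    ConcaveOn ℝ (hyperbolicityCone f e)
      (fun x => (MvPolynomial.eval x f / MvPolynomial.eval e f) ^ ((d : ℝ)⁻¹)) := by
  refine ⟨convex_hyperbolicityCone hf he, fun x hx y hy a b ha hb hab => ?_⟩
  rcases ha.eq_or_lt with rfl | ha'
  · rw [zero_add] at hab
    subst hab
    simp
  rcases hb.eq_or_lt with rfl | hb'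
  · rw [add_zero] at hab
    subst hab
    simp
  have hax := smul_mem_hyperbolicityCone hf hx ha'
  have hby := smul_mem_hyperbolicityCone hf hy hb'
  have h := rpow_eval_add_ge hf he hd hax hby
  rw [rpow_eval_smul hf he hd hx ha, rpow_eval_smul hf he hd hy hb] at h
  simpa only [smul_eq_mul] using h

/-- **Gårding's inequality (concave form) on the open cone `K(p; d) = Λ₊₊`**, as stated by Güler:
"the function `p(x)^{1/m}` is concave and homogeneous of degree `1` in `K(p; d)`" (here normalised by
`p(d)`). [cite: Guler1997, Lemma 3.1] -/
theorem concaveOn_rpow_eval_openHyperbolicityCone (hf : f.IsHomogeneous d) (he : IsHyperbolic f e)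
    (hd : 0 < d) :
    ConcaveOn ℝ (openHyperbolicityCone f e)
      (fun x => (MvPolynomial.eval x f / MvPolynomial.eval e f) ^ ((d : ℝ)⁻¹)) :=
  (concaveOn_rpow_eval_hyperbolicityCone hf he hd).subset (openHyperbolicityCone_subset f e)
    (convex_openHyperbolicityCone hf he)

/-- **Polynomial form**: `p(x + y)/p(e) ≥ p(x)/p(e) + p(y)/p(e)` for `x, y ∈ Λ₊(p, e)` (`m ≥ 1`), from the
superadditive form and `uᵐ + wᵐ ≤ (u + w)ᵐ`. [cite: Guler1997, Lemma 3.1 (consequence)] -/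
theorem eval_add_ge_add (hf : f.IsHomogeneous d) (he : IsHyperbolic f e) (hd : 0 < d) {x y : σ → ℝ}
    (hx : x ∈ hyperbolicityCone f e) (hy : y ∈ hyperbolicityCone f e) :
    MvPolynomial.eval x f / MvPolynomial.eval e f + MvPolynomial.eval y f / MvPolynomial.eval e f ≤
      MvPolynomial.eval (x + y) f / MvPolynomial.eval e f := by
  have hd0 : d ≠ 0 := hd.ne'
  have hxy : x + y ∈ hyperbolicityCone f e := by
    have h := convex_hyperbolicityCone hf he hx hy (a := 2⁻¹) (b := 2⁻¹) (by norm_num) (by norm_num)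
      (by norm_num)
    have h2 := smul_mem_hyperbolicityCone hf h (c := 2) two_pos
    rwa [smul_add, smul_smul, smul_smul, mul_inv_cancel₀ (two_ne_zero), one_smul, one_smul] at h2
  have h := rpow_eval_add_ge hf he hd hx hy
  have hux := Real.rpow_nonneg (eval_div_eval_nonneg hf he hx) ((d : ℝ)⁻¹)
  have huy := Real.rpow_nonneg (eval_div_eval_nonneg hf he hy) ((d : ℝ)⁻¹)
  have h1 := pow_add_pow_le hux huy hd0
  have h2 := pow_le_pow_left₀ (add_nonneg hux huy) h d
  rw [Real.rpow_inv_natCast_pow (eval_div_eval_nonneg hf he hx) hd0,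
    Real.rpow_inv_natCast_pow (eval_div_eval_nonneg hf he hy) hd0] at h1
  rw [Real.rpow_inv_natCast_pow (eval_div_eval_nonneg hf he hxy) hd0] at h2
  exact h1.trans h2

end Garding

/-! ## §4 Gårding: `λ_min` is superadditive (the largest characteristic root is sublinear) -/

section LambdaMin

variable {σ : Type*} {f : MvPolynomial σ ℝ} {d : ℕ} {e : σ → ℝ}

/-- Shifting along the direction shifts the eigenvalues: `λ ∈ λ(x - a e) ↔ λ + a ∈ λ(x)`.
[cite: Renegar2006, §2] -/
theorem mem_eigenvalues_sub_smul_iff (hf : f.IsHomogeneous d) (he : MvPolynomial.eval e f ≠ 0)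
    (x : σ → ℝ) (a lam : ℝ) : lam ∈ eigenvalues f e (x - a • e) ↔ lam + a ∈ eigenvalues f e x := by
  rw [mem_eigenvalues_iff hf he, mem_eigenvalues_iff hf he, sub_sub, ← add_smul, add_comm a lam]

/-- `λ_min(x) ≥ a` iff `x - a e ∈ Λ₊` (Renegar: `Λ₊ = {x : λ_min(x) ≥ 0}`). [cite: Renegar2006, §2] -/
theorem forall_eigenvalues_ge_iff_sub_smul_mem (hf : f.IsHomogeneous d) (he : IsHyperbolic f e)
    (x : σ → ℝ) (a : ℝ) :
    (∀ lam ∈ eigenvalues f e x, a ≤ lam) ↔ x - a • e ∈ hyperbolicityCone f e := by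
  rw [mem_hyperbolicityCone_iff_eigenvalues_nonneg hf he]
  constructor
  · intro h lam hlam
    have := h _ ((mem_eigenvalues_sub_smul_iff hf he.eval_ne_zero x a lam).1 hlam)
    linarith
  · intro h lam hlam
    have := h (lam - a) ((mem_eigenvalues_sub_smul_iff hf he.eval_ne_zero x a (lam - a)).2
      (by rwa [sub_add_cancel]))
    linarith

/-- `Λ₊` is closed under addition (a convex cone). [cite: Garding1959, Thm 2] -/
theorem add_mem_hyperbolicityCone (hf : f.IsHomogeneous d) (he : IsHyperbolic f e) {x y : σ → ℝ}
    (hx : x ∈ hyperbolicityCone f e) (hy : y ∈ hyperbolicityCone f e) : x + y ∈ hyperbolicityCone f e := by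
  have h := convex_hyperbolicityCone hf he hx hy (a := 2⁻¹) (b := 2⁻¹) (by norm_num) (by norm_num)
    (by norm_num)
  have h2 := smul_mem_hyperbolicityCone hf h (c := 2) two_pos
  rwa [smul_add, smul_smul, smul_smul, mul_inv_cancel₀ (two_ne_zero), one_smul, one_smul] at h2

/-- **Gårding: `λ_min` is superadditive** (Gårding 1959, Thm 2: `λ_m` is concave; Bauschke–Güler–Lewis–
Sendov, Thm. 2.5: "The largest characteristic root `λ₁(·)` is a sublinear function", `λ₁(-x) = -λ_m(x)`):
if every eigenvalue of `x` is `≥ a` and every eigenvalue of `y` is `≥ b`, then every eigenvalue of `x + y`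
is `≥ a + b`. [cite: BauschkeEtAl2001, Thm. 2.5] [cite: Garding1959, Thm 2] -/
theorem eigenvalues_add_ge (hf : f.IsHomogeneous d) (he : IsHyperbolic f e) {x y : σ → ℝ} {a b : ℝ}
    (hx : ∀ lam ∈ eigenvalues f e x, a ≤ lam) (hy : ∀ lam ∈ eigenvalues f e y, b ≤ lam) :
    ∀ lam ∈ eigenvalues f e (x + y), a + b ≤ lam := by
  rw [forall_eigenvalues_ge_iff_sub_smul_mem hf he] at hx hy ⊢
  have h := add_mem_hyperbolicityCone hf he hx hy
  have hxy : x + y - (a • e + b • e) = x - a • e + (y - b • e) := by abel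
  rw [add_smul, hxy]
  exact h

/-- Positive homogeneity of the eigenvalue bounds: eigenvalues of `c • x` (`c > 0`) are `≥ c a` when those
of `x` are `≥ a`. [cite: BauschkeEtAl2001, Fact 2.4 / Thm. 2.5] -/
theorem eigenvalues_smul_ge (hf : f.IsHomogeneous d) (he : IsHyperbolic f e) {x : σ → ℝ} {a c : ℝ}
    (hc : 0 < c) (hx : ∀ lam ∈ eigenvalues f e x, a ≤ lam) :
    ∀ lam ∈ eigenvalues f e (c • x), c * a ≤ lam := by
  rw [forall_eigenvalues_ge_iff_sub_smul_mem hf he] at hx ⊢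
  have h := smul_mem_hyperbolicityCone hf hx hc
  rwa [smul_sub, smul_smul] at h

end LambdaMin

end Literature.AlgebraicGeometry.HyperbolicPolynomials
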